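import Summits.AtomisticToContinuum.HydrodynamicLimit.Theorems.LambertianContactSwapLambertianEulerKlLedger
import Summits.AtomisticToContinuum.HydrodynamicLimit.Theorems.LambertianContactSwapLambertianEulerLawSemigroup
import HarnessLib

/-!
# The one-window entropy ledger of the Lambertian gas (crux `LambertianEuler`, stmt-AtomisticToContinuum-11854, line `Sketch`, stub `stub_windowLedgerLambda`)

Worker file (`--supports stmt-AtomisticToContinuum-11854`) closing the registered stub
`stub_windowLedgerLambda` of the skeleton `Cruxes/LambertianEuler/Lines/Sketch.lean`: the
window-by-window form of the first line of Yau's relative-entropy method for the LAMBERTIAN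
hard-sphere gas `Λ` on `𝕋³` (`lambertFlow G ε ξs z t`: free flight + hard-sphere collisions at
which the outgoing relative velocity of the colliding pair is redrawn with the cosine law from the
i.i.d. Gaussian noise `ξs ~ γ^ℕ = lambertNoise (Fin 3)`).

**Statement.** Let `0 < σ < 1/2`, `N + 1` spheres of diameter `hsDiameter σ N`, a flow `Φ`,
`λ_N = localGibbsLaw σ a₀ u₀ θ₀ N Φ` the initial local Gibbs law and
`ψ = localGibbsLaw σ b w ϑ N Φ`, `ψ' = localGibbsLaw σ b' w' ϑ' N Φ` two local Gibbs references
(all profiles continuous and positive), with canonical densities `ρ_ψ`, `ρ_{ψ'}`. Write `μ_r` for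
the law of `Λ_r` under the annealed initial law `λ_N ⊗ γ^ℕ`. Then for `s, h ≥ 0`:

* `KL(μ_{s+h} ‖ ψ') < ∞`, and
* `KL(μ_{s+h} ‖ ψ') - KL(μ_s ‖ ψ) ≤ E_{μ_s ⊗ γ^ℕ}[log ρ_ψ(z) - log ρ_{ψ'}(Λ_h(z, ξs))]`.

**Proof route.**
1. CHAPMAN–KOLMOGOROV in law (`…LawSemigroup.stub_lawSemigroupLambda`, landed):
   `μ_{s+h} = (μ_s ⊗ γ^ℕ) ∘ Λ_h⁻¹` — the law of `Λ_{s+h}` is the law of `Λ_h` run with fresh noise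
   from `μ_s` (uses `λ_N ≪ liouville`, immediate since `localGibbsLaw = particleLaw = ρ dL`).
2. The LEDGER `…KlLedger.stub_klLedgerLambda` (landed) at the initial law `P := μ_s`, references
   `ψ` (time `0` of the window) and `ψ'` (time `h`), horizon `h`. Its four side conditions:
   * `μ_s` is a probability law (`Measure.isProbabilityMeasure_map`, joint measurability
     `measurable_lambertFlow_hsDiameter`);
   * `μ_s ≪ liouville`: `λ_N ⊗ γ^ℕ ≪ L ⊗ γ^ℕ` (`AbsolutelyContinuous.prod`) pushes forward through
     `Λ_s` (`AbsolutelyContinuous.map`) and `(L ⊗ γ^ℕ) ∘ Λ_s⁻¹ = L` is the `Λ`-LIOUVILLE THEOREM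
     `…SwapGapLiouvilleInvarianceLambda.stub_liouvilleInvarianceLambda`;
   * the kinetic energy `Σ_i |v_i|²` is `μ_s`-integrable: `integrable_map_measure` and the PATHWISE
     energy monotonicity `configEnergy_lambertFlow_le` of `Λ` reduce it to the `λ_N`-integrability
     of `Σ_i |v_i|²` (`QuenchedCellClock.integrable_sum_norm_sq_localGibbsLaw`, Gaussian velocity
     marginals);
   * `KL(μ_s ‖ ψ) < ∞`: clause 1 of the same ledger run from time `0` with `P := λ_N`, references
     `λ_N` (so `KL(λ_N ‖ λ_N) = 0`, `klDiv_self`) and `ψ`, horizon `s`.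
3. After the rewrite of step 1 the conclusion of step 2 is literally the goal.

References: H.-T. Yau, *Relative entropy and hydrodynamics of Ginzburg–Landau models*, Lett. Math.
Phys. 22 (1991), §2; S. Olla, S. R. S. Varadhan, H.-T. Yau, *Hydrodynamical limit for a Hamiltonian
system with weak noise*, Comm. Math. Phys. 155 (1993), §3 (entropy ledger by data processing for
the noisy dynamics, restarted window by window by the Markov property).
prover-line-stmt-AtomisticToContinuum-11854-c2-0 (lead c2), stub worker.
-/

noncomputable section

namespace Summit.AtomisticToContinuum.HydrodynamicLimit.Theorems.LambertianContactSwapLambertianEulerWindowLedger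

open scoped BigOperators Topology ENNReal InnerProductSpace
open MeasureTheory ProbabilityTheory Filter Set InformationTheory
open Literature.MathematicalPhysics.KineticTheory
open Literature.Analysis.FluidPDE Literature.Analysis.FluidPDE.Alexander
open Summit.AtomisticToContinuum.HydrodynamicLimit.Theorems.LambertianContactSwapLambertianEulerKlLedger
open Summit.AtomisticToContinuum.HydrodynamicLimit.Theorems.LambertianContactSwapLambertianEulerLawSemigroup
open Summit.AtomisticToContinuum.HydrodynamicLimit.Theorems.LambertianContactSwapSwapGapLiouvilleInvarianceLambda

/-! ### §1 The law of `Λ_s` started from a local Gibbs law -/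

/-- **The law of `Λ_s` is absolutely continuous with respect to Liouville** whenever the initial
law is: `P ⊗ γ^ℕ ≪ L ⊗ γ^ℕ` pushes forward through the jointly measurable `Λ_s`, and
`(L ⊗ γ^ℕ) ∘ Λ_s⁻¹ = L` is the `Λ`-Liouville theorem (`stub_liouvilleInvarianceLambda`).
[folklore] -/
theorem map_lambertFlow_absolutelyContinuous_liouville {σ : ℝ} (hσ : 0 < σ) (hσ' : σ < 2⁻¹)
    (N : ℕ) {P : Measure (Config (N + 1) (Fin 3) T3)} [SFinite P]
    (hPL : P ≪ liouville (Torus.geometry (Fin 3)) (N + 1) (hsDiameter σ N)) {s : ℝ} (hs : 0 ≤ s) :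
    (P.prod (lambertNoise (Fin 3))).map
        (fun p => lambertFlow (Torus.geometry (Fin 3)) (hsDiameter σ N) p.2 p.1 s) ≪
      liouville (Torus.geometry (Fin 3)) (N + 1) (hsDiameter σ N) := by
  have hε : 0 < hsDiameter σ N := hsDiameter_pos hσ N
  have hε' : hsDiameter σ N < 2⁻¹ := (hsDiameter_le hσ.le N).trans_lt hσ'
  have h := (hPL.prod (Measure.AbsolutelyContinuous.rfl (μ := lambertNoise (Fin 3)))).map
    (measurable_lambertFlow_hsDiameter hσ.le hσ' N s)
  rwa [stub_liouvilleInvarianceLambda (hsDiameter σ N) hε hε' (N + 1) s hs] at h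

/-- **The kinetic energy is integrable under the law of `Λ_s`** whenever it is under the (finite)
initial law: `integrable_map_measure` and the pathwise energy monotonicity
`configEnergy_lambertFlow_le` of the Lambertian flow. [folklore] -/
theorem integrable_sum_norm_sq_map_lambertFlow {σ : ℝ} (hσ : 0 < σ) (hσ' : σ < 2⁻¹) (N : ℕ)
    {P : Measure (Config (N + 1) (Fin 3) T3)} [IsFiniteMeasure P]
    (hE : Integrable (fun z : Config (N + 1) (Fin 3) T3 => ∑ i, ‖(z i).2‖ ^ 2) P) (s : ℝ) :
    Integrable (fun z : Config (N + 1) (Fin 3) T3 => ∑ i, ‖(z i).2‖ ^ 2)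
      ((P.prod (lambertNoise (Fin 3))).map
        (fun p => lambertFlow (Torus.geometry (Fin 3)) (hsDiameter σ N) p.2 p.1 s)) := by
  have hΛ := measurable_lambertFlow_hsDiameter hσ.le hσ' N s
  have hm : Measurable fun z : Config (N + 1) (Fin 3) T3 => ∑ i, ‖(z i).2‖ ^ 2 := by fun_prop
  refine (integrable_map_measure hm.aestronglyMeasurable hΛ.aemeasurable).2 ?_
  refine (hE.comp_fst (lambertNoise (Fin 3))).mono' (hm.comp hΛ).aestronglyMeasurable
    (Eventually.of_forall fun p => ?_)
  rw [Real.norm_eq_abs, abs_of_nonneg (Finset.sum_nonneg fun i _ => sq_nonneg _)]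
  have h := configEnergy_lambertFlow_le (G := Torus.geometry (Fin 3)) (ε := hsDiameter σ N)
    p.2 p.1 s
  simp only [configEnergy] at h
  show ∑ i, ‖(lambertFlow (Torus.geometry (Fin 3)) (hsDiameter σ N) p.2 p.1 s i).2‖ ^ 2 ≤
    ∑ i, ‖(p.1 i).2‖ ^ 2
  linarith

/-! ### §2 The stub -/

/-- **Registered stub `stub_windowLedgerLambda` of line `Sketch` — the one-window relative-entropy
LEDGER of the Lambertian gas.** For `0 < σ < 1/2`, the initial local Gibbs law
`λ_N = localGibbsLaw σ a₀ u₀ θ₀ N Φ` and two local Gibbs references `ψ = localGibbsLaw σ b w ϑ N Φ`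
(time `s`), `ψ' = localGibbsLaw σ b' w' ϑ' N Φ` (time `s + h`), all profiles continuous and
positive, every `N`, flow `Φ` and `s, h ≥ 0`: writing `μ_r` for the law of `Λ_r` under
`λ_N ⊗ γ^ℕ`, `KL(μ_{s+h} ‖ ψ') ≠ ∞` and
`KL(μ_{s+h} ‖ ψ') - KL(μ_s ‖ ψ) ≤ E_{μ_s ⊗ γ^ℕ}[log ρ_ψ(z) - log ρ_{ψ'}(Λ_h(z, ξs))]`.
Route: `μ_{s+h} = (μ_s ⊗ γ^ℕ) ∘ Λ_h⁻¹` (`stub_lawSemigroupLambda`) and the ledger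
`stub_klLedgerLambda` at `P := μ_s` — a probability law, `≪ liouville`
(`map_lambertFlow_absolutelyContinuous_liouville`), with integrable kinetic energy
(`integrable_sum_norm_sq_map_lambertFlow`, `QuenchedCellClock.integrable_sum_norm_sq_localGibbsLaw`)
and `KL(μ_s ‖ ψ) ≠ ∞` (clause 1 of the ledger from time `0` with `P := λ_N`, `KL(λ_N ‖ λ_N) = 0`).
[cite: Yau1991, §2] -/
theorem stub_windowLedgerLambda :
    ∀ {σ : ℝ}, 0 < σ → σ < 2⁻¹ → ∀ {a₀ θ₀ b ϑ b' ϑ' : T3 → ℝ} {u₀ w w' : T3 → V3},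
      Continuous a₀ → Continuous θ₀ → Continuous u₀ → (∀ x, 0 < a₀ x) → (∀ x, 0 < θ₀ x) →
      Continuous b → Continuous ϑ → Continuous w → (∀ x, 0 < b x) → (∀ x, 0 < ϑ x) →
      Continuous b' → Continuous ϑ' → Continuous w' → (∀ x, 0 < b' x) → (∀ x, 0 < ϑ' x) →
      ∀ (N : ℕ) (Φ : HardSphereFlow (Torus.geometry (Fin 3)) (hsDiameter σ N) (N + 1)) (s h : ℝ),
        0 ≤ s → 0 ≤ h →
        klDiv (((localGibbsLaw σ a₀ u₀ θ₀ N Φ).prod (lambertNoise (Fin 3))).map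
            (fun p => lambertFlow (Torus.geometry (Fin 3)) (hsDiameter σ N) p.2 p.1 (s + h)))
          (localGibbsLaw σ b' w' ϑ' N Φ) ≠ ⊤ ∧
        (klDiv (((localGibbsLaw σ a₀ u₀ θ₀ N Φ).prod (lambertNoise (Fin 3))).map
            (fun p => lambertFlow (Torus.geometry (Fin 3)) (hsDiameter σ N) p.2 p.1 (s + h)))
          (localGibbsLaw σ b' w' ϑ' N Φ)).toReal -
          (klDiv (((localGibbsLaw σ a₀ u₀ θ₀ N Φ).prod (lambertNoise (Fin 3))).map
            (fun p => lambertFlow (Torus.geometry (Fin 3)) (hsDiameter σ N) p.2 p.1 s))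
          (localGibbsLaw σ b w ϑ N Φ)).toReal ≤
        ∫ q, (Real.log (canonicalDensity (Torus.geometry (Fin 3)) (hsDiameter σ N) (N + 1)
                (localGibbsProfile b w ϑ) q.1) -
              Real.log (canonicalDensity (Torus.geometry (Fin 3)) (hsDiameter σ N) (N + 1)
                (localGibbsProfile b' w' ϑ')
                (lambertFlow (Torus.geometry (Fin 3)) (hsDiameter σ N) q.2 q.1 h)))
          ∂(((((localGibbsLaw σ a₀ u₀ θ₀ N Φ).prod (lambertNoise (Fin 3))).map
              (fun p => lambertFlow (Torus.geometry (Fin 3)) (hsDiameter σ N) p.2 p.1 s))).prod (lambertNoise (Fin 3))) := by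
  intro σ hσ hσ' a₀ θ₀ b ϑ b' ϑ' u₀ w w' ha hθ hu ha0 hθ0 hb hϑ hw hb0 hϑ0 hb' hϑ' hw' hb0' hϑ0'
    N Φ s h hs hh
  have hσ2 : σ ≤ 1 / 2 := by rw [one_div]; exact hσ'.le
  -- the initial local Gibbs law: a probability law `≪ liouville` with integrable kinetic energy
  haveI i₀ : IsProbabilityMeasure (localGibbsLaw σ a₀ u₀ θ₀ N Φ) :=
    isProbabilityMeasure_localGibbsLaw ha hθ hu ha0 hθ0 hσ2 N Φ
  have hPL : localGibbsLaw σ a₀ u₀ θ₀ N Φ ≪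
      liouville (Torus.geometry (Fin 3)) (N + 1) (hsDiameter σ N) := by
    rw [localGibbsLaw, particleLaw_eq]; exact withDensity_absolutelyContinuous _ _
  have hEn₀ := QuenchedCellClock.integrable_sum_norm_sq_localGibbsLaw ha hθ hu (fun x => (ha0 x).le)
    hθ0 N Φ
  have hK₀ : klDiv (localGibbsLaw σ a₀ u₀ θ₀ N Φ) (localGibbsLaw σ a₀ u₀ θ₀ N Φ) ≠ ⊤ := by
    rw [klDiv_self]; exact ENNReal.zero_ne_top
  -- the law `μ_s` of `Λ_s`: the four side conditions of the ledger
  haveI i₁ : IsProbabilityMeasure (((localGibbsLaw σ a₀ u₀ θ₀ N Φ).prod (lambertNoise (Fin 3))).map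
      (fun p => lambertFlow (Torus.geometry (Fin 3)) (hsDiameter σ N) p.2 p.1 s)) :=
    Measure.isProbabilityMeasure_map (measurable_lambertFlow_hsDiameter hσ.le hσ' N s).aemeasurable
  have hμL := map_lambertFlow_absolutelyContinuous_liouville hσ hσ' N hPL hs
  have hEn := integrable_sum_norm_sq_map_lambertFlow hσ hσ' N hEn₀ s
  have hK : klDiv (((localGibbsLaw σ a₀ u₀ θ₀ N Φ).prod (lambertNoise (Fin 3))).map
      (fun p => lambertFlow (Torus.geometry (Fin 3)) (hsDiameter σ N) p.2 p.1 s))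
      (localGibbsLaw σ b w ϑ N Φ) ≠ ⊤ :=
    (stub_klLedgerLambda hσ hσ' ha hθ hu ha0 hθ0 hb hϑ hw hb0 hϑ0 N Φ (localGibbsLaw σ a₀ u₀ θ₀ N Φ)
      hPL hEn₀ hK₀ s hs).1
  -- Chapman–Kolmogorov at time `s + h`, then the ledger over the window `[s, s + h]`
  rw [stub_lawSemigroupLambda hσ hσ' N (localGibbsLaw σ a₀ u₀ θ₀ N Φ) hPL s h hs hh]
  exact stub_klLedgerLambda hσ hσ' hb hϑ hw hb0 hϑ0 hb' hϑ' hw' hb0' hϑ0' N Φ _ hμL hEn hK h hh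

end Summit.AtomisticToContinuum.HydrodynamicLimit.Theorems.LambertianContactSwapLambertianEulerWindowLedger

end
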